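/-
COR-CM (cells pub-hodgecm ∕ pub-hodgecm2, stage 2 of the Hodge ladder) — Δ2 BRIDGE, TOP ROW «Ω AT δ′», sequel (c) of
`CorCM/D2Bridge/OmegaAtDeltaPrime.lean`: THE LINE-OF-RECORD PACKAGING.  The pinned dictionary's index line over a class with real
non-zero Gram scalar `a ∈ F` is the `SplitLine` with `J_W′ = diagonal (fun _ ↦ a)`, `T_W′ = realDiagonal F (fun _ ↦ a) _`
(port `Model/LiuDictionaryPin`, `SplitLineE.ofCM V e₁ (vec a) …`); R1 wants `ω(μ, ε_a, χ)` realised ON that line.  This file fixes, once,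
the representative section `repOfLine F a ha ha0 := Rep.update Rep.ofLineOf (locF u_a) u_a rfl` (`u_a := OmegaTransport.realUnit F a ha ha0`)
and re-keys `restOfCharDeltaPrime ∕ admIndexAtDeltaPrime ∕ omegaTransportAtDeltaPrime` by `a`: the line-of-record equalities
`J_W (r_a ε_a) = diagonal (fun _ ↦ a)`, `T_W (r_a ε_a) = realDiagonal F (fun _ ↦ a) _` are `Rep.update_toFun_self` (a `simp` lemma, not `rfl`)
composed with `OmegaTransport.JW_realUnit ∕ TW_realUnit`, and the orientation hypothesis is stated AT `a` —
`hΦ : ∀ τ ∈ Φ_μ, 0 < Im τ(δ_F · a)` — the literal socket of the port's `SignRecipe.mem_lineType_iff` (`η_L = δ_L`), transported to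
`admIndexAtDeltaPrime`'s `hΦ` by `OmegaTransport.algebraMap_update_locF` + `algebraMap_realUnit` (SECOND d2bridge-prove-1 g1, review note R-iii).
What remains for the pin after this file: supply `hΦ` from `HasCMType μ Φ^δ(a)` and the package's `IsAutChar χ` unfolding — equalities of
tree objects, no print content (referee OBJECT-MATCH-DELTAPRIME §3).
Seat prover-pub-hodgecm2-d2bridge-prove-4-g1-0 (Δ2 bridge prove-4 gen 1, PEN of the top row).  Abbreviations + theorems only; no named fact,
no instance, no `variable`; nothing landed is edited or restated.  HC_CM is NOT proved; «Δ2 BRIDGE CLOSED» is NOT claimed; hLiu = «[Liu21]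
Thm 4.18 at the constructed objects AS A READING (r8 stronger-in-X; Δ2 bridge OPEN)»; no pointer moves.
-/
import Summits.HodgeConjecture.CorCM.D2Bridge.OmegaAtDeltaPrime
import HarnessLib

set_option autoImplicit false

/-!
# R1 at δ′, keyed by the Gram scalar `a` of the line of record

* `Model.repOfLine F a ha ha0` (+ `repOfLine_toFun_self`, `algebraMap_repOfLine_toFun_self`, `JW_repOfLine`, `TW_repOfLine`);
* `Model.restOfCharDeltaPrimeLine … a ha ha0 μ hμ hw := restOfCharDeltaPrime … (repOfLine F a ha ha0) μ hμ hw`;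
* `Model.admIndexAtDeltaPrimeLine … (hΦ : ∀ τ ∈ Φ_μ, 0 < Im τ(δ_F·a)) χ` (= `σ_a`), `admIndexAtDeltaPrimeLine_fst`, `admIndexAtDeltaPrimeLine_injective`;
* `Model.omegaTransportAtDeltaPrimeLine … hW′ hWd′ hJW′ hs′ χ` (= `e_a` at `(realDiagonal F (fun _ ↦ a) _, diagonal (fun _ ↦ a))`),
  `omegaTransportAtDeltaPrimeLine_mk`, `omegaTransportAtDeltaPrimeLine_smul` (= `he_a`).

HC_CM is NOT proved.
-/

noncomputable section

open scoped TensorProduct Matrix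

namespace Summit.HodgeConjecture.CorCM.Model

open CategoryTheory CategoryTheory.Limits AlgebraicGeometry NumberField IsDedekindDomain
open Literature.AlgebraicGeometry.Motives
open Literature.AlgebraicGeometry.HodgeTheory
open Literature.AlgebraicGeometry.ShimuraVarieties
open Literature.AlgebraicGeometry.ShimuraVarieties.UnitaryCanonicalModel
open Literature.AlgebraicGeometry.Liu2021 (IsAdmissibleElement)
open Literature.NumberTheory.ComplexMultiplication
open Literature.NumberTheory.Automorphic
open Literature.NumberTheory.Automorphic.IdeleClassGroup
open Literature.NumberTheory.Automorphic.PicardCM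
open Literature.NumberTheory.Automorphic.Liu2021
open Literature.NumberTheory.Automorphic.Liu2021.AppendixC
open Literature.NumberTheory.Automorphic.Liu2021.AppendixC.RestOne
open Literature.NumberTheory.Automorphic.Liu2021.Def411WeilCarriers (JW TW isSymm_TW isUnit_det_TW JW_eq JW_apply_ne_zero locF lineOf Rep
  Eps Chi epsOf omegaAtLine rhoAtLine rhoVAtLine lineChar)
open Literature.NumberTheory.GelbartRogawski1991 Literature.NumberTheory.GelbartRogawski1991.UnitaryDualPair
open Literature.NumberTheory.Weil1964 Literature.RepresentationTheory
open Literature.RepresentationTheory.Liu2021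
open Summit.HodgeConjecture.CorCM.Transposition
open Summit.HodgeConjecture.CorCM.Transposition.OmegaTransport

/-! ## §1 The representative section re-pointed at the line of record -/

section RepOfLine

variable (F : CMField)

/-- **`r_a`** — the faithful representative section taking the value `u_a` (the `(F⁺)ˣ`-unit of the real non-zero Gram scalar `a`) at the
collection `locF u_a`, and the tree's `lineOf` elsewhere: with it the Liu carrier at the collection of the line of record sits ON the line
`⟨a⟩`. [cite: Liu2021, Def. 4.12 (FJcycle.tex l. 2102–2108)] -/
abbrev repOfLine (a : F) (ha : IsCMField.complexConj F a = a) (ha0 : a ≠ 0) : Rep ↥(maximalRealSubfield F) (imagUnitSq F) :=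
  Rep.update ↥(maximalRealSubfield F) (imagUnitSq F) (Rep.ofLineOf ↥(maximalRealSubfield F) (imagUnitSq F))
    (locF ↥(maximalRealSubfield F) (imagUnitSq F) (realUnit F a ha ha0)) (realUnit F a ha ha0) rfl

/-- `r_a (locF u_a) = u_a` (`Rep.update_toFun_self`). [folklore] -/
@[simp] theorem repOfLine_toFun_self (a : F) (ha : IsCMField.complexConj F a = a) (ha0 : a ≠ 0) :
    (repOfLine F a ha ha0).toFun (locF ↥(maximalRealSubfield F) (imagUnitSq F) (realUnit F a ha ha0)) = realUnit F a ha ha0 :=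
  Rep.update_toFun_self _ _ _ _ _ _

/-- … read in `F`: `a`. [folklore] -/
@[simp] theorem algebraMap_repOfLine_toFun_self (a : F) (ha : IsCMField.complexConj F a = a) (ha0 : a ≠ 0) :
    algebraMap ↥(maximalRealSubfield F) F
        ((repOfLine F a ha ha0).toFun (locF ↥(maximalRealSubfield F) (imagUnitSq F) (realUnit F a ha ha0))) = a := by
  rw [repOfLine_toFun_self]
  rfl

/-- **`J_W(r_a ε_a) = diagonal (fun _ ↦ a)`** — the line of record's Gram matrix. [folklore] -/
theorem JW_repOfLine (a : F) (ha : IsCMField.complexConj F a = a) (ha0 : a ≠ 0) :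
    JW ↥(maximalRealSubfield F) F
        ((repOfLine F a ha ha0).toFun (locF ↥(maximalRealSubfield F) (imagUnitSq F) (realUnit F a ha ha0))) =
      Matrix.diagonal fun _ : Fin 1 => a :=
  (JW_update_locF F _ _).trans (JW_realUnit F a ha ha0)

/-- **`T_W(r_a ε_a) = realDiagonal F (fun _ ↦ a) _`**. [folklore] -/
theorem TW_repOfLine (a : F) (ha : IsCMField.complexConj F a = a) (ha0 : a ≠ 0) :
    TW ↥(maximalRealSubfield F)
        ((repOfLine F a ha ha0).toFun (locF ↥(maximalRealSubfield F) (imagUnitSq F) (realUnit F a ha ha0))) =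
      realDiagonal F (fun _ : Fin 1 => a) fun _ => ha :=
  (TW_update_locF F _ _).trans (TW_realUnit F a ha ha0)

/-- the orientation hypothesis AT `a` (`0 < Im τ(δ_F·a)` on `Φ`, the port's `Φ^δ(a)`) is `admIndexAtDeltaPrime`'s `hΦ` at `r_a ε_a`. [folklore] -/
theorem deltaPos_repOfLine (Φ : CMType F) (a : F) (ha : IsCMField.complexConj F a = a) (ha0 : a ≠ 0)
    (hΦ : ∀ τ : F →+* ℂ, τ ∈ Φ.1 → 0 < (τ (imagUnit F * a)).im) :
    ∀ τ : F →+* ℂ, τ ∈ Φ.1 → 0 < (τ (imagUnit F * algebraMap ↥(maximalRealSubfield F) F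
      ((repOfLine F a ha ha0).toFun (locF ↥(maximalRealSubfield F) (imagUnitSq F) (realUnit F a ha ha0))))).im := by
  rw [algebraMap_repOfLine_toFun_self]
  exact hΦ

end RepOfLine

/-! ## §2 The rest, `σ_a`, `e_a` keyed by `a` -/

section Line

/-- **the δ′ rest realised on the line of record `⟨a⟩`** (`restOfCharDeltaPrime` at `r := repOfLine F a ha ha0`).
[cite: Liu2021, Def. 4.11 (FJcycle.tex l. 2088–2096), Def. 4.12 (l. 2102–2108), Def. 4.16 (l. 2219)] -/
abbrev restOfCharDeltaPrimeLine (h : exists_recordSystem) (F : CMField) [IsGalois ℚ F] (h6 : 6 ≤ Module.finrank ℚ F)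
    (ι₁ : F →+* ℂ) (V : HermSpace3 F ι₁) (Φ : CMType F) {n : ℕ} (e : Fin 3 × Fin 1 ≃ Fin n) (dV : Fin 3 → F)
    (hdV : ∀ i, IsCMField.complexConj F (dV i) = dV i) (hdV0 : ∀ i, dV i ≠ 0)
    (ιV : (sec42DataOf h isoOf F ι₁ V Φ).G →*
      UnitaryGroup.finAdelic ↥(maximalRealSubfield F) F (IsCMField.complexConj F) 3 (Matrix.diagonal dV))
    (a : F) (ha : IsCMField.complexConj F a = a) (ha0 : a ≠ 0)
    (μ : IdeleClassGroup F →ₜ* Circle) (hμ : IdeleClassGroup.IsConjugateSymplectic F μ) (hw : IdeleClassGroup.HasWeight F μ 1) :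
    Thm418Rest (sec42DataOf h isoOf F ι₁ V Φ) :=
  restOfCharDeltaPrime h F h6 ι₁ V Φ e dV hdV hdV0 ιV (repOfLine F a ha ha0) μ hμ hw

/-- **`σ_a`** — the admissible index `(locF u_a, χ ∘ centre)` of the δ′ rest on the line of record, for a character `χ` of
`U(diagonal (fun _ ↦ a))(𝔸_f)` with open kernel and trivial rational restriction, under the orientation hypothesis AT `a`; its printed
Def. 4.12 label is `e₀ = a·(2δ_F)⁻¹`. [cite: Liu2021, Def. 4.12 (FJcycle.tex l. 2102–2108), Thm. 4.18 (l. 2232–2237)] -/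
abbrev admIndexAtDeltaPrimeLine (h : exists_recordSystem) (F : CMField) [IsGalois ℚ F] (h6 : 6 ≤ Module.finrank ℚ F)
    (ι₁ : F →+* ℂ) (V : HermSpace3 F ι₁) (Φ : CMType F) {n : ℕ} (e : Fin 3 × Fin 1 ≃ Fin n) (dV : Fin 3 → F)
    (hdV : ∀ i, IsCMField.complexConj F (dV i) = dV i) (hdV0 : ∀ i, dV i ≠ 0)
    (ιV : (sec42DataOf h isoOf F ι₁ V Φ).G →*
      UnitaryGroup.finAdelic ↥(maximalRealSubfield F) F (IsCMField.complexConj F) 3 (Matrix.diagonal dV))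
    (a : F) (ha : IsCMField.complexConj F a = a) (ha0 : a ≠ 0)
    (μ : IdeleClassGroup F →ₜ* Circle) (hμ : IdeleClassGroup.IsConjugateSymplectic F μ) (hw : IdeleClassGroup.HasWeight F μ 1)
    (hΦ : ∀ τ : F →+* ℂ, τ ∈ hμ.cmType.1 → 0 < (τ (imagUnit F * a)).im)
    (χ : {χ : ↥(UnitaryGroup.finAdelic ↥(maximalRealSubfield F) F (IsCMField.complexConj F) 1 (Matrix.diagonal fun _ : Fin 1 => a)) →* ℂˣ //
      IsOpen ((χ.ker : Subgroup _) : Set ↥(UnitaryGroup.finAdelic ↥(maximalRealSubfield F) F (IsCMField.complexConj F) 1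
        (Matrix.diagonal fun _ : Fin 1 => a))) ∧
        ∀ γ : UnitaryGroup.rational ↥(maximalRealSubfield F) F (IsCMField.complexConj F) 1 (Matrix.diagonal fun _ : Fin 1 => a),
          χ (UnitaryGroup.rationalToFinAdelic ↥(maximalRealSubfield F) F (IsCMField.complexConj F) 1
            (Matrix.diagonal fun _ : Fin 1 => a) γ) = 1}) :
    (toThm418Data (sec42DataOf h isoOf F ι₁ V Φ)
      (restOfCharDeltaPrimeLine h F h6 ι₁ V Φ e dV hdV hdV0 ιV a ha ha0 μ hμ hw)).AdmIndex :=
  admIndexAtDeltaPrime h F h6 ι₁ V Φ e dV hdV hdV0 ιV (repOfLine F a ha ha0) μ hμ hw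
    (locF ↥(maximalRealSubfield F) (imagUnitSq F) (realUnit F a ha ha0)) ⟨realUnit F a ha ha0, rfl⟩
    (deltaPos_repOfLine F hμ.cmType a ha ha0 hΦ) (Matrix.diagonal fun _ : Fin 1 => a) (JW_repOfLine F a ha ha0) χ

/-- the `Eps`-label of `σ_a χ` is `locF u_a`, the δ′-collection of the printed label `a·(2δ_F)⁻¹`. [cite: Liu2021, Def. 4.12 (FJcycle.tex l. 2102–2108)] -/
theorem admIndexAtDeltaPrimeLine_fst (h : exists_recordSystem) (F : CMField) [IsGalois ℚ F] (h6 : 6 ≤ Module.finrank ℚ F)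
    (ι₁ : F →+* ℂ) (V : HermSpace3 F ι₁) (Φ : CMType F) {n : ℕ} (e : Fin 3 × Fin 1 ≃ Fin n) (dV : Fin 3 → F)
    (hdV : ∀ i, IsCMField.complexConj F (dV i) = dV i) (hdV0 : ∀ i, dV i ≠ 0)
    (ιV : (sec42DataOf h isoOf F ι₁ V Φ).G →*
      UnitaryGroup.finAdelic ↥(maximalRealSubfield F) F (IsCMField.complexConj F) 3 (Matrix.diagonal dV))
    (a : F) (ha : IsCMField.complexConj F a = a) (ha0 : a ≠ 0)
    (μ : IdeleClassGroup F →ₜ* Circle) (hμ : IdeleClassGroup.IsConjugateSymplectic F μ) (hw : IdeleClassGroup.HasWeight F μ 1)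
    (hΦ : ∀ τ : F →+* ℂ, τ ∈ hμ.cmType.1 → 0 < (τ (imagUnit F * a)).im)
    (χ : {χ : ↥(UnitaryGroup.finAdelic ↥(maximalRealSubfield F) F (IsCMField.complexConj F) 1 (Matrix.diagonal fun _ : Fin 1 => a)) →* ℂˣ //
      IsOpen ((χ.ker : Subgroup _) : Set ↥(UnitaryGroup.finAdelic ↥(maximalRealSubfield F) F (IsCMField.complexConj F) 1
        (Matrix.diagonal fun _ : Fin 1 => a))) ∧
        ∀ γ : UnitaryGroup.rational ↥(maximalRealSubfield F) F (IsCMField.complexConj F) 1 (Matrix.diagonal fun _ : Fin 1 => a),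
          χ (UnitaryGroup.rationalToFinAdelic ↥(maximalRealSubfield F) F (IsCMField.complexConj F) 1
            (Matrix.diagonal fun _ : Fin 1 => a) γ) = 1}) :
    (admIndexAtDeltaPrimeLine h F h6 ι₁ V Φ e dV hdV hdV0 ιV a ha ha0 μ hμ hw hΦ χ).1.1 =
      locF ↥(maximalRealSubfield F) (imagUnitSq F) (realUnit F a ha ha0) :=
  rfl

/-- **`hσ_a`** — `σ_a` is injective in `χ`. [cite: Liu2021, Thm. 4.18 (FJcycle.tex l. 2232–2237)] -/
theorem admIndexAtDeltaPrimeLine_injective (h : exists_recordSystem) (F : CMField) [IsGalois ℚ F] (h6 : 6 ≤ Module.finrank ℚ F)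
    (ι₁ : F →+* ℂ) (V : HermSpace3 F ι₁) (Φ : CMType F) {n : ℕ} (e : Fin 3 × Fin 1 ≃ Fin n) (dV : Fin 3 → F)
    (hdV : ∀ i, IsCMField.complexConj F (dV i) = dV i) (hdV0 : ∀ i, dV i ≠ 0)
    (ιV : (sec42DataOf h isoOf F ι₁ V Φ).G →*
      UnitaryGroup.finAdelic ↥(maximalRealSubfield F) F (IsCMField.complexConj F) 3 (Matrix.diagonal dV))
    (a : F) (ha : IsCMField.complexConj F a = a) (ha0 : a ≠ 0)
    (μ : IdeleClassGroup F →ₜ* Circle) (hμ : IdeleClassGroup.IsConjugateSymplectic F μ) (hw : IdeleClassGroup.HasWeight F μ 1)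
    (hΦ : ∀ τ : F →+* ℂ, τ ∈ hμ.cmType.1 → 0 < (τ (imagUnit F * a)).im) :
    Function.Injective (admIndexAtDeltaPrimeLine h F h6 ι₁ V Φ e dV hdV hdV0 ιV a ha ha0 μ hμ hw hΦ) :=
  admIndexAtDeltaPrime_injective h F h6 ι₁ V Φ e dV hdV hdV0 ιV _ μ hμ hw _ _ _ _ _

set_option maxHeartbeats 2000000 in
/-- **`e_a`** — the package's Weil `χ`-coinvariant module at `(T_W′, J_W′) = (realDiagonal F (fun _ ↦ a) _, diagonal (fun _ ↦ a))`, splitting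
`ι_{toHecke μ}`, pulled back along `ιV`, ≃ `ω(μ, ε_a, χ ∘ centre)` = `omegaAt (σ_a χ)` of the δ′ rest on the line of record
(`omegaTransportAtDeltaPrime` at `r_a`; the port's own proofs `hW′ hWd′ hJW′` of the line's Gram data are binders, any others are equal to them).
[cite: Liu2021, Def. 4.11 (FJcycle.tex l. 2092–2096), App. D §D.1 Steps 1–3 (l. 5215–5221)] [cite: GelbartRogawski1991, §3.1 Prop. 3.1.1 p. 455 L1–3] -/
abbrev omegaTransportAtDeltaPrimeLine (h : exists_recordSystem) (F : CMField) [IsGalois ℚ F] (h6 : 6 ≤ Module.finrank ℚ F)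
    (ι₁ : F →+* ℂ) (V : HermSpace3 F ι₁) (Φ : CMType F) {n : ℕ} (e : Fin 3 × Fin 1 ≃ Fin n) (dV : Fin 3 → F)
    (hdV : ∀ i, IsCMField.complexConj F (dV i) = dV i) (hdV0 : ∀ i, dV i ≠ 0)
    (ιV : (sec42DataOf h isoOf F ι₁ V Φ).G →*
      UnitaryGroup.finAdelic ↥(maximalRealSubfield F) F (IsCMField.complexConj F) 3 (Matrix.diagonal dV))
    (a : F) (ha : IsCMField.complexConj F a = a) (ha0 : a ≠ 0)
    (μ : IdeleClassGroup F →ₜ* Circle) (hμ : IdeleClassGroup.IsConjugateSymplectic F μ) (hw : IdeleClassGroup.HasWeight F μ 1)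
    (hΦ : ∀ τ : F →+* ℂ, τ ∈ hμ.cmType.1 → 0 < (τ (imagUnit F * a)).im)
    (hW' : (realDiagonal F (fun _ : Fin 1 => a) fun _ => ha).IsSymm) (hWd' : IsUnit (realDiagonal F (fun _ : Fin 1 => a) fun _ => ha).det)
    (hJW' : (Matrix.diagonal fun _ : Fin 1 => a) =
      (realDiagonal F (fun _ : Fin 1 => a) fun _ => ha).map (algebraMap ↥(maximalRealSubfield F) F))
    (hs' : (splittingDatum ↥(maximalRealSubfield F) F (IsCMField.complexConj F) 3 1 e (Matrix.diagonal dV)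
        (Matrix.diagonal fun _ : Fin 1 => a)
        (complexConj_imagUnit F) (imagUnit_ne_zero F) (imagUnit_mul_self F) (realDiagonal_isSymm F dV hdV) hW'
        (isUnit_det_realDiagonal F dV hdV hdV0) hWd' (realDiagonal_map F dV hdV).symm hJW').IsCompatible
      (Def411WeilCarriersDoubling.chiSplittingLine F e dV hdV hdV0 (toHeckeCharacter F μ) (isUnitary_toHeckeCharacter F μ)
        ((isOscillatorChar_toHeckeCharacter_iff μ).mpr hμ) (realDiagonal F (fun _ : Fin 1 => a) fun _ => ha) hWd'
        (Matrix.diagonal fun _ : Fin 1 => a) hJW'))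
    (χ : {χ : ↥(UnitaryGroup.finAdelic ↥(maximalRealSubfield F) F (IsCMField.complexConj F) 1 (Matrix.diagonal fun _ : Fin 1 => a)) →* ℂˣ //
      IsOpen ((χ.ker : Subgroup _) : Set ↥(UnitaryGroup.finAdelic ↥(maximalRealSubfield F) F (IsCMField.complexConj F) 1
        (Matrix.diagonal fun _ : Fin 1 => a))) ∧
        ∀ γ : UnitaryGroup.rational ↥(maximalRealSubfield F) F (IsCMField.complexConj F) 1 (Matrix.diagonal fun _ : Fin 1 => a),
          χ (UnitaryGroup.rationalToFinAdelic ↥(maximalRealSubfield F) F (IsCMField.complexConj F) 1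
            (Matrix.diagonal fun _ : Fin 1 => a) γ) = 1}) :
    Representation.asModule
        ((HodgeCM.WeilCoinv.weilCoinv ↥(maximalRealSubfield F) F (IsCMField.complexConj F) 3 1 e (Matrix.diagonal dV)
          (Matrix.diagonal fun _ : Fin 1 => a)
          (complexConj_imagUnit F) (imagUnit_ne_zero F) (imagUnit_mul_self F) (realDiagonal_isSymm F dV hdV) hW'
          (isUnit_det_realDiagonal F dV hdV hdV0) hWd' (realDiagonal_map F dV hdV).symm hJW' χ.1 hs').comp ιV) ≃ₗ[ℂ]
      (toThm418Data (sec42DataOf h isoOf F ι₁ V Φ)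
          (restOfCharDeltaPrimeLine h F h6 ι₁ V Φ e dV hdV hdV0 ιV a ha ha0 μ hμ hw)).omegaAt
        (admIndexAtDeltaPrimeLine h F h6 ι₁ V Φ e dV hdV hdV0 ιV a ha ha0 μ hμ hw hΦ χ) :=
  omegaTransportAtDeltaPrime h F h6 ι₁ V Φ e dV hdV hdV0 ιV (repOfLine F a ha ha0) μ hμ hw
    (locF ↥(maximalRealSubfield F) (imagUnitSq F) (realUnit F a ha ha0)) ⟨realUnit F a ha ha0, rfl⟩
    (deltaPos_repOfLine F hμ.cmType a ha ha0 hΦ) (realDiagonal F (fun _ : Fin 1 => a) fun _ => ha)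
    (Matrix.diagonal fun _ : Fin 1 => a) hW' hWd' hJW' (TW_repOfLine F a ha ha0) (JW_repOfLine F a ha ha0) hs' χ

set_option maxHeartbeats 2000000 in
/-- `e_a` on generators: the class of `f ∈ 𝒮` goes to the class of `f`. [cite: Liu2021, App. D §D.1 Step 3 (FJcycle.tex l. 5221)] -/
theorem omegaTransportAtDeltaPrimeLine_mk (h : exists_recordSystem) (F : CMField) [IsGalois ℚ F] (h6 : 6 ≤ Module.finrank ℚ F)
    (ι₁ : F →+* ℂ) (V : HermSpace3 F ι₁) (Φ : CMType F) {n : ℕ} (e : Fin 3 × Fin 1 ≃ Fin n) (dV : Fin 3 → F)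
    (hdV : ∀ i, IsCMField.complexConj F (dV i) = dV i) (hdV0 : ∀ i, dV i ≠ 0)
    (ιV : (sec42DataOf h isoOf F ι₁ V Φ).G →*
      UnitaryGroup.finAdelic ↥(maximalRealSubfield F) F (IsCMField.complexConj F) 3 (Matrix.diagonal dV))
    (a : F) (ha : IsCMField.complexConj F a = a) (ha0 : a ≠ 0)
    (μ : IdeleClassGroup F →ₜ* Circle) (hμ : IdeleClassGroup.IsConjugateSymplectic F μ) (hw : IdeleClassGroup.HasWeight F μ 1)
    (hΦ : ∀ τ : F →+* ℂ, τ ∈ hμ.cmType.1 → 0 < (τ (imagUnit F * a)).im)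
    (hW' : (realDiagonal F (fun _ : Fin 1 => a) fun _ => ha).IsSymm) (hWd' : IsUnit (realDiagonal F (fun _ : Fin 1 => a) fun _ => ha).det)
    (hJW' : (Matrix.diagonal fun _ : Fin 1 => a) =
      (realDiagonal F (fun _ : Fin 1 => a) fun _ => ha).map (algebraMap ↥(maximalRealSubfield F) F))
    (hs' : (splittingDatum ↥(maximalRealSubfield F) F (IsCMField.complexConj F) 3 1 e (Matrix.diagonal dV)
        (Matrix.diagonal fun _ : Fin 1 => a)
        (complexConj_imagUnit F) (imagUnit_ne_zero F) (imagUnit_mul_self F) (realDiagonal_isSymm F dV hdV) hW'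
        (isUnit_det_realDiagonal F dV hdV hdV0) hWd' (realDiagonal_map F dV hdV).symm hJW').IsCompatible
      (Def411WeilCarriersDoubling.chiSplittingLine F e dV hdV hdV0 (toHeckeCharacter F μ) (isUnitary_toHeckeCharacter F μ)
        ((isOscillatorChar_toHeckeCharacter_iff μ).mpr hμ) (realDiagonal F (fun _ : Fin 1 => a) fun _ => ha) hWd'
        (Matrix.diagonal fun _ : Fin 1 => a) hJW'))
    (χ : {χ : ↥(UnitaryGroup.finAdelic ↥(maximalRealSubfield F) F (IsCMField.complexConj F) 1 (Matrix.diagonal fun _ : Fin 1 => a)) →* ℂˣ //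
      IsOpen ((χ.ker : Subgroup _) : Set ↥(UnitaryGroup.finAdelic ↥(maximalRealSubfield F) F (IsCMField.complexConj F) 1
        (Matrix.diagonal fun _ : Fin 1 => a))) ∧
        ∀ γ : UnitaryGroup.rational ↥(maximalRealSubfield F) F (IsCMField.complexConj F) 1 (Matrix.diagonal fun _ : Fin 1 => a),
          χ (UnitaryGroup.rationalToFinAdelic ↥(maximalRealSubfield F) F (IsCMField.complexConj F) 1
            (Matrix.diagonal fun _ : Fin 1 => a) γ) = 1})
    (f : FinSB ↥(maximalRealSubfield F) (Fin 3 × Fin 1)) :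
    omegaTransportAtDeltaPrimeLine h F h6 ι₁ V Φ e dV hdV hdV0 ιV a ha ha0 μ hμ hw hΦ hW' hWd' hJW' hs' χ (Submodule.Quotient.mk f) =
      Submodule.Quotient.mk f :=
  omegaTransportAtDeltaPrime_mk h F h6 ι₁ V Φ e dV hdV hdV0 ιV _ μ hμ hw _ _ _ _ _ hW' hWd' hJW' _ _ hs' χ f

set_option maxHeartbeats 2000000 in
/-- **`he_a`** — `e_a` is `𝔾(𝔸^∞)`-equivariant. [cite: Liu2021, Def. 4.11 (FJcycle.tex l. 2092–2096), App. D §D.1 Step 3 (l. 5221)] -/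
theorem omegaTransportAtDeltaPrimeLine_smul (h : exists_recordSystem) (F : CMField) [IsGalois ℚ F] (h6 : 6 ≤ Module.finrank ℚ F)
    (ι₁ : F →+* ℂ) (V : HermSpace3 F ι₁) (Φ : CMType F) {n : ℕ} (e : Fin 3 × Fin 1 ≃ Fin n) (dV : Fin 3 → F)
    (hdV : ∀ i, IsCMField.complexConj F (dV i) = dV i) (hdV0 : ∀ i, dV i ≠ 0)
    (ιV : (sec42DataOf h isoOf F ι₁ V Φ).G →*
      UnitaryGroup.finAdelic ↥(maximalRealSubfield F) F (IsCMField.complexConj F) 3 (Matrix.diagonal dV))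
    (a : F) (ha : IsCMField.complexConj F a = a) (ha0 : a ≠ 0)
    (μ : IdeleClassGroup F →ₜ* Circle) (hμ : IdeleClassGroup.IsConjugateSymplectic F μ) (hw : IdeleClassGroup.HasWeight F μ 1)
    (hΦ : ∀ τ : F →+* ℂ, τ ∈ hμ.cmType.1 → 0 < (τ (imagUnit F * a)).im)
    (hW' : (realDiagonal F (fun _ : Fin 1 => a) fun _ => ha).IsSymm) (hWd' : IsUnit (realDiagonal F (fun _ : Fin 1 => a) fun _ => ha).det)
    (hJW' : (Matrix.diagonal fun _ : Fin 1 => a) =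
      (realDiagonal F (fun _ : Fin 1 => a) fun _ => ha).map (algebraMap ↥(maximalRealSubfield F) F))
    (hs' : (splittingDatum ↥(maximalRealSubfield F) F (IsCMField.complexConj F) 3 1 e (Matrix.diagonal dV)
        (Matrix.diagonal fun _ : Fin 1 => a)
        (complexConj_imagUnit F) (imagUnit_ne_zero F) (imagUnit_mul_self F) (realDiagonal_isSymm F dV hdV) hW'
        (isUnit_det_realDiagonal F dV hdV hdV0) hWd' (realDiagonal_map F dV hdV).symm hJW').IsCompatible
      (Def411WeilCarriersDoubling.chiSplittingLine F e dV hdV hdV0 (toHeckeCharacter F μ) (isUnitary_toHeckeCharacter F μ)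
        ((isOscillatorChar_toHeckeCharacter_iff μ).mpr hμ) (realDiagonal F (fun _ : Fin 1 => a) fun _ => ha) hWd'
        (Matrix.diagonal fun _ : Fin 1 => a) hJW'))
    (χ : {χ : ↥(UnitaryGroup.finAdelic ↥(maximalRealSubfield F) F (IsCMField.complexConj F) 1 (Matrix.diagonal fun _ : Fin 1 => a)) →* ℂˣ //
      IsOpen ((χ.ker : Subgroup _) : Set ↥(UnitaryGroup.finAdelic ↥(maximalRealSubfield F) F (IsCMField.complexConj F) 1
        (Matrix.diagonal fun _ : Fin 1 => a))) ∧
        ∀ γ : UnitaryGroup.rational ↥(maximalRealSubfield F) F (IsCMField.complexConj F) 1 (Matrix.diagonal fun _ : Fin 1 => a),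
          χ (UnitaryGroup.rationalToFinAdelic ↥(maximalRealSubfield F) F (IsCMField.complexConj F) 1
            (Matrix.diagonal fun _ : Fin 1 => a) γ) = 1})
    (g : (sec42DataOf h isoOf F ι₁ V Φ).G)
    (m : Representation.asModule
        ((HodgeCM.WeilCoinv.weilCoinv ↥(maximalRealSubfield F) F (IsCMField.complexConj F) 3 1 e (Matrix.diagonal dV)
          (Matrix.diagonal fun _ : Fin 1 => a)
          (complexConj_imagUnit F) (imagUnit_ne_zero F) (imagUnit_mul_self F) (realDiagonal_isSymm F dV hdV) hW'
          (isUnit_det_realDiagonal F dV hdV hdV0) hWd' (realDiagonal_map F dV hdV).symm hJW' χ.1 hs').comp ιV)) :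
    omegaTransportAtDeltaPrimeLine h F h6 ι₁ V Φ e dV hdV hdV0 ιV a ha ha0 μ hμ hw hΦ hW' hWd' hJW' hs' χ
        (MonoidAlgebra.of ℂ (sec42DataOf h isoOf F ι₁ V Φ).G g • m) =
      (toThm418Data (sec42DataOf h isoOf F ι₁ V Φ)
          (restOfCharDeltaPrimeLine h F h6 ι₁ V Φ e dV hdV hdV0 ιV a ha ha0 μ hμ hw)).rhoAt
        (admIndexAtDeltaPrimeLine h F h6 ι₁ V Φ e dV hdV hdV0 ιV a ha ha0 μ hμ hw hΦ χ) g
        (omegaTransportAtDeltaPrimeLine h F h6 ι₁ V Φ e dV hdV hdV0 ιV a ha ha0 μ hμ hw hΦ hW' hWd' hJW' hs' χ m) :=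
  omegaTransportAtDeltaPrime_smul h F h6 ι₁ V Φ e dV hdV hdV0 ιV _ μ hμ hw _ _ _ _ _ hW' hWd' hJW' _ _ hs' χ g m

end Line

end Summit.HodgeConjecture.CorCM.Model

end
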